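/-
Copyright (c) 2026. All rights reserved.
Released under Apache 2.0 license as described in the file LICENSE.
-/
import Literature.Probability.FitznerVanDerHofstad2017.SrwKTwoSupD10
import Literature.Probability.FitznerVanDerHofstad2017.SrwITableD10V000002
import Literature.Probability.FitznerVanDerHofstad2017.SrwUSupKUSepD10
import HarnessLib

/-!
# The far class `x = [6,6]` folded into the shell-law majorant of `W_{n,j}(6e₀; 10)`, and the far axis tails re-derived

Reproduction (what-if / input-certification lane at the SRW-table parameter `d := 10`) of one step of the
`K`/`U`-table machinery of

* R. Fitzner, R. van der Hofstad, *Generalized approach to the non-backtracking lace expansion*,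
  Probab. Theory Relat. Fields 169 (2017) 1041–1119, arXiv:1506.07969 — §5.2 (5.9) p. 1091 (the Cauchy–Schwarz
  splits `K_{n,l}(x)² ≤ I_{n,2m}(0)·W_{n,j}(x)`, `U_{n,l}(x)² ≤ V_{n,2l}·L_n(x)`), (5.15) p. 1092 (monotonicity
  along an axis), (5.16) p. 1092 (the shell law `W_{n,j}(x) = (2^d d!)⁻¹ Σ_ρ I_{n,2j}(x − ρx)`), Rem. 5.1 p. 1090
  (positionwise domination `|I_{n,l}(x)| ≤ I_{n,l}(y)` for `|y| ≤ |x|` coordinatewise); the accompanying notebook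
  `SRW.nb` of *Mean-field behavior for nearest-neighbor percolation in `d > 10`*, Electron. J. Probab. 22 (2017),
  arXiv:1506.07977, is the primary source of the published `d = 11` verification.

What is reproduced here.  The tree bounds the far axis tails `|m| ≥ 6` of `K_{n,2}(m e_i; 10)` (`SrwKTwoSupD10`) and of
`U_{n,0}, U_{n,2}` (`SrwUSupKUSepD10`) by the splits (5.9) at the node `6e₀`, reading the shell-law majorant
`KTwoSupD10.w6 n j ≥ W_{n,j}(6e₀; 10)` whose shell terms are `KSupD10.termDom` values — the least cached class value
among the 27 tabulated classes dominated positionwise (Rem. 5.1).  At scale `6` with one non-zero coordinate the shell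
law reads exactly three terms, `W_{n,j}(6e₀) = (I_{n,2j}(0) + I_{n,2j}(12e₀))/(2d) + (d−1)/d · I_{n,2j}(6e₀+6e₁)`, and
`termDom` books the last (dominant) one at the class `[6]`.  This module folds the kernel-certified two-point table at
the far class `x = [6,6]` (`ITableD10V000002`, carver-g49) in front of `termDom` as ONE extra `min`
(`termDomF`, sound by `absMonotone_srwI` + the table enclosure), giving `w6F n j ≥ W_{n,j}(6e₀; 10)` (`1 ≤ n ≤ 4`,
`j ≤ 22`; the extra class is read for `j ≤ 11`), and re-derives with it the far tails `K_{3,2}, K_{4,2}` (`m' = 1`, `j = 1`),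
`U_{4,0}`, `U_{4,2}` for `|m| ≥ 6` and the one region supremum whose binding item was that tail,
`sup_{‖x‖₁ ≥ 3} U_{4,0}(x; 10)` (cells `m = 3,4,5` of `SrwUZeroAxisCellsD10` + the `‖x‖₁ ≥ 3` nodes
`USupKUSepD10.bThree 4` + the new tail, assembled by `srwU_le_of_axisFamily_nodeBounds_three_cast`).
Typing spec: enum1-g58 `W6F_TYPING_SPEC.md` (2026-08-22); values cross-checked by the numerics engines A/B before filing
(provenance only — no engine value is a hypothesis).

This is an INPUT-CERTIFICATION module: unconditional real-analysis inequalities about `srwW 10`, `srwK 10`, `srwU 10`;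
it fixes `d = 10` only inside its namespace, has no `(h : <cited fact>)` binder, edits nothing landed (new namespace
`WSixFarD10`), asserts nothing about any bootstrap, instantiates no `…Of`/`…At` certificate and makes no statement about any
dimension; the record files of the `d = 11` verification are untouched.
-/

set_option maxHeartbeats 1000000

namespace Literature.Probability.FitznerVanDerHofstad2017

open _root_.MeasureTheory Finset
open KTUD10 KSupD10 KTwoSupD10 TUSupD10 USupKUSepD10 UZeroCellD10 SeedCert

namespace WSixFarD10

/-! ### §1  The far class folded into the term majorant, and `w6F` -/

/-- The cached upper value of `I_{n,2j}` at the far class `x = [6,6]`: `ITableD10V000002.tabHi n (2j)`.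
[cite: FitznerVanDerHofstad2016NoBLE, (5.16) p. 1092, Rem. 5.1 p. 1090] -/
def iUpF (n j : ℕ) : ℚ := ITableD10V000002.tabHi n (2 * j)

/-- `I_{n,2j}([6,6]; 10) ≤ iUpF n j` (`n ≤ 4`, `j ≤ 11`). [cite: FitznerVanDerHofstad2016NoBLE, (5.16) p. 1092, Rem. 5.1 p. 1090] -/
theorem iUpF_valid (n : ℕ) (hn : n ≤ 4) (j : ℕ) (hj : j ≤ 11) :
    srwI 10 n (2 * j) (clsPt 10 [6, 6]) ≤ ((iUpF n j : ℚ) : ℝ) :=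
  (ITableD10V000002.srwI_tab_encl_d10_v000002 n hn (2 * j) (by omega)).2

/-- Positionwise domination test `|w_μ| ≤ |z_μ|` read back (local copy of the private `KSupD10.domLe_sound`). [folklore] -/
private theorem wf_domLe_sound {z w : Fin 10 → ℤ} (h : domLe z w = true) : ∀ μ, |w μ| ≤ |z μ| := by
  intro μ
  unfold domLe at h
  have := (List.all_eq_true.1 h) μ (List.mem_finRange μ)
  simpa using this

/-- TERM MAJORANT WITH THE FAR CLASS: `termDom n j z`, and in front of it — when `z` dominates `[6,6]` positionwise and
`j ≤ 11` — the cached far-class value `iUpF n j`. [cite: FitznerVanDerHofstad2016NoBLE, (5.16) p. 1092, Rem. 5.1 p. 1090] -/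
def termDomF (n j : ℕ) (z : Fin 10 → ℤ) : ℚ :=
  if domLe z (clsPt 10 [6, 6]) && decide (j ≤ 11) then min (iUpF n j) (termDom n j z) else termDom n j z

/-- **Soundness of `termDomF`**: `I_{n,2j}(z; 10) ≤ termDomF n j z` (`1 ≤ n ≤ 4`, `j ≤ 22`, every `z`).
[cite: FitznerVanDerHofstad2016NoBLE, (5.16) p. 1092, Rem. 5.1 p. 1090] -/
theorem termDomF_sound {n : ℕ} (hn1 : 1 ≤ n) (hn : n ≤ 4) {j : ℕ} (hj : j ≤ 22) (z : Fin 10 → ℤ) :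
    srwI 10 n (2 * j) z ≤ ((termDomF n j z : ℚ) : ℝ) := by
  unfold termDomF
  split_ifs with h
  · simp only [Bool.and_eq_true, decide_eq_true_eq] at h
    obtain ⟨hdom, hj'⟩ := h
    push_cast
    exact le_min ((absMonotone_srwI (d := 10) hn1 (by omega) (2 * j) z _ (wf_domLe_sound hdom)).trans
      (iUpF_valid n hn j hj')) (termDom_sound hn1 hn hj z)
  · exact termDom_sound hn1 hn hj z

/-- The shell-law majorant of `W_{n,j}(6e₀; 10)` at scale `6` reading `termDomF`. [cite: FitznerVanDerHofstad2016NoBLE, (5.16) p. 1092, Rem. 5.1 p. 1090] -/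
def w6F (n j : ℕ) : ℚ := shellWTabQ 10 (fun a b => termDomF n j ((6 : ℤ) • classVec 10 a b)) 1

/-- `6·1_{μ<1} = 6e₀ = vecOfParts 10 [6]`. [folklore] -/
private theorem wf_six_smul_indicator : ((6 : ℤ) • indicatorVec (lowSet 10 1) : Fin 10 → ℤ) = vecOfParts 10 [6] := by
  decide +kernel

/-- **`W_{n,j}(6e₀; 10) ≤ w6F n j`** (`1 ≤ n ≤ 4`, `j ≤ 22`). [cite: FitznerVanDerHofstad2016NoBLE, (5.16) p. 1092, Rem. 5.1 p. 1090] -/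
theorem srwW_six_le_w6F (n : ℕ) (hn1 : 1 ≤ n) (hn4 : n ≤ 4) (j : ℕ) (hj : j ≤ 22) :
    srwW 10 n j (vecOfParts 10 [6]) ≤ ((w6F n j : ℚ) : ℝ) := by
  have h := srwW_smul_lowSet_le_shellWTabQ_of_termBound (d := 10) (n := n) (by omega) j 6 1
    (B := fun a b => termDomF n j ((6 : ℤ) • classVec 10 a b)) (fun a b _ => termDomF_sound hn1 hn4 hj _)
  rwa [wf_six_smul_indicator] at h

/-- **`L_n(6e₀; 10) ≤ w6F n 0`** (`1 ≤ n ≤ 4`). [cite: FitznerVanDerHofstad2016NoBLE, (5.16) p. 1092, Rem. 5.1 p. 1090] -/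
theorem srwL_six_le_w6F (n : ℕ) (hn1 : 1 ≤ n) (hn4 : n ≤ 4) :
    srwL 10 n (vecOfParts 10 [6]) ≤ ((w6F n 0 : ℚ) : ℝ) := by
  rw [← srwW_zero]
  exact srwW_six_le_w6F n hn1 hn4 0 (by norm_num)

/-! ### §2  The far axis tails `|m| ≥ 6` re-derived with `w6F` -/

/-- **`K_{3,2}(m e_i; 10) ≤ 0.035098` for every `|m| ≥ 6`** (CS split `m' = 1`, `j = 1` at the node `6e₀`, `W ≤ w6F 3 1`;
`KTwoSupD10.srwK_two_far6_d10_n3`: 0.035403). [cite: FitznerVanDerHofstad2016NoBLE, (5.15)–(5.16) p. 1092] -/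
theorem srwK_two_far6F_d10_n3 (i : Fin 10) (m : ℤ) (hm : 6 ≤ m.natAbs) :
    srwK 10 3 2 (Pi.single i m) ≤ ((35098 / 1000000 : ℚ) : ℝ) :=
  srwK_axisFamily_of_seedBounds_cast (d := 10) (n := 3) (by norm_num) (by norm_num) i 6 1 1 rfl
    (i0_valid (n := 3) (by norm_num) (m := 1) (by norm_num)) (srwW_six_le_w6F 3 (by norm_num) (by norm_num) 1 (by norm_num))
    (by norm_num) (by decide +kernel) m hm

/-- **`K_{4,2}(m e_i; 10) ≤ 0.097729` for every `|m| ≥ 6`** (CS split `m' = 1`, `j = 1` at the node `6e₀`, `W ≤ w6F 4 1`;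
`KTwoSupD10.srwK_two_far6_d10_n4`: 0.106589). [cite: FitznerVanDerHofstad2016NoBLE, (5.15)–(5.16) p. 1092] -/
theorem srwK_two_far6F_d10_n4 (i : Fin 10) (m : ℤ) (hm : 6 ≤ m.natAbs) :
    srwK 10 4 2 (Pi.single i m) ≤ ((97729 / 1000000 : ℚ) : ℝ) :=
  srwK_axisFamily_of_seedBounds_cast (d := 10) (n := 4) (by norm_num) (by norm_num) i 6 1 1 rfl
    (i0_valid (n := 4) (by norm_num) (m := 1) (by norm_num)) (srwW_six_le_w6F 4 (by norm_num) (by norm_num) 1 (by norm_num))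
    (by norm_num) (by decide +kernel) m hm

/-- **`U_{4,0}(m e_i; 10) ≤ 0.0239482` for every `|m| ≥ 6`** — the split (5.9) `√V_{4,0} √L_4` at the node `6e₀`
(`V ≤ KTUD10.vUp 4 0`, `L_4(6e₀) ≤ w6F 4 0`), moved down the axis by (5.15); `USupKUSepD10.srwU_zero_far6_d10_n4`: 0.0244540.
[cite: FitznerVanDerHofstad2016NoBLE, §5.2 (5.9) p. 1091, (5.15)–(5.16) p. 1092] -/
theorem srwU_zero_far6F_d10_n4 (i : Fin 10) (m : ℤ) (hm : 6 ≤ m.natAbs) :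
    srwU 10 4 0 (Pi.single i m) ≤ ((239482 / 10000000 : ℚ) : ℝ) :=
  srwU_axisFamily_of_seedBounds_cast (d := 10) (n := 4) (by norm_num) (by norm_num) 0 i 6
    (vUp_sound (n := 4) (by norm_num) (by norm_num) (l := 0) (by norm_num)) (srwL_six_le_w6F 4 (by norm_num) (by norm_num))
    (by norm_num) (by decide +kernel) m hm

/-- **`U_{4,2}(m e_i; 10) ≤ 0.0045067` for every `|m| ≥ 6`** — the split (5.9) `√V_{4,4} √L_4` at the node `6e₀`
(`V ≤ KTUD10.vUp 4 2`, `L_4(6e₀) ≤ w6F 4 0`), moved down the axis by (5.15); `USupKUSepD10.srwU_two_far6_d10_n4`: 0.0046019.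
[cite: FitznerVanDerHofstad2016NoBLE, §5.2 (5.9) p. 1091, (5.15)–(5.16) p. 1092] -/
theorem srwU_two_far6F_d10_n4 (i : Fin 10) (m : ℤ) (hm : 6 ≤ m.natAbs) :
    srwU 10 4 2 (Pi.single i m) ≤ ((45067 / 10000000 : ℚ) : ℝ) :=
  srwU_axisFamily_of_seedBounds_cast (d := 10) (n := 4) (by norm_num) (by norm_num) 2 i 6
    (vUp_sound (n := 4) (by norm_num) (by norm_num) (l := 2) (by norm_num)) (srwL_six_le_w6F 4 (by norm_num) (by norm_num))
    (by norm_num) (by decide +kernel) m hm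


/-! ### §3  The region supremum of `U_{4,0}` over `‖x‖₁ ≥ 3`, re-cut with the new tail -/

/-- `2e₀ + 2e₁ = vecOfParts 10 [2, 2]` as `Pi.single`s. [folklore] -/
private theorem wf_vecOfParts_two_two : vecOfParts 10 [2, 2] = Pi.single 0 2 + Pi.single 1 2 := by decide +kernel

/-- Equal absolute profiles give equal level-set counts (local copy of the private `USupKUSepD10` helper). [folklore] -/
private theorem wf_card_abs_eq_of_absProf_eq {z z' : Fin 10 → ℤ} (h : absProf z = absProf z') (v : ℤ) :
    Fintype.card {μ // |z μ| = v} = Fintype.card {μ // |z' μ| = v} := by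
  have key : ∀ w : Fin 10 → ℤ, Fintype.card {μ // |w μ| = v} = Multiset.card ((absProf w).filter (· = v)) := by
    intro w
    rw [Fintype.card_subtype, absProf, Multiset.filter_map, Multiset.card_map]
    rfl
  rw [key, key, h]

/-- `W_{n,j}(2e₁+e₂) = W_{n,j}(e₁+2e₂)` (same `W_d`-orbit). [cite: FitznerVanDerHofstad2016NoBLE, (5.16) p. 1092] -/
private theorem wf_srwW_vecOfParts_two_one (n j : ℕ) :
    srwW 10 n j (vecOfParts 10 [2, 1]) = srwW 10 n j (Nd.pt .e12) := by
  have hp : absProf (vecOfParts 10 [2, 1]) = absProf (Nd.pt .e12) := by decide +kernel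
  obtain ⟨τ, hτ⟩ := exists_spAct_eq_of_card_abs_eq _ _ (wf_card_abs_eq_of_absProf_eq hp)
  rw [← hτ, srwW_spAct]

/-- `L_n(2e₁+e₂; 10) ≤ wTab n 0 e12`. [cite: FitznerVanDerHofstad2016NoBLE, (5.16) p. 1092] -/
private theorem wf_srwL_two_one_le {n : ℕ} (hn1 : 1 ≤ n) (hn : n ≤ 4) :
    srwL 10 n (vecOfParts 10 [2, 1]) ≤ ((wTab n 0 .e12 : ℚ) : ℝ) := by
  rw [← srwW_zero, wf_srwW_vecOfParts_two_one]
  exact wTab_valid .e12 hn1 hn (Nat.zero_le _)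

/-- `L_n(2e₁+2e₂; 10) ≤ pdTab n 0`. [cite: FitznerVanDerHofstad2016NoBLE, (5.16) p. 1092] -/
private theorem wf_srwL_two_two_le {n : ℕ} (hn1 : 1 ≤ n) (hn : n ≤ 4) :
    srwL 10 n (vecOfParts 10 [2, 2]) ≤ ((pdTab n 0 : ℚ) : ℝ) := by
  rw [← srwW_zero, wf_vecOfParts_two_two]
  exact pdTab_valid hn1 hn (Nat.zero_le _)

/-- `U_{n,l}` is `W_d`-invariant. [cite: FitznerVanDerHofstad2016NoBLE, (3.38) p. 1071] -/
private theorem wf_uInv (n l : ℕ) : SpInvariant (srwU 10 n l) := fun τ x => srwU_spAct n l τ x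

/-- `wOnes n 0 r ≤ USupKUSepD10.bThree n` for `3 ≤ r ≤ 10`, `n ≤ 4` (local copy). [folklore] -/
private theorem wf_wOnes_le_bThree : ∀ n ≤ 4, ∀ r ≤ 10, 3 ≤ r → wOnes n 0 r ≤ bThree n := by decide +kernel

/-- **`U_{4,0}(x; 10) ≤ 0.0239482` whenever `Σ_μ |x_μ| ≥ 3`** (re-cut of `USupKUSepD10.srwU_zero_le_of_three_le_d10_n4` = 0.0244540
with the far tail `srwU_zero_far6F_d10_n4` 0.0239482 in place of 0.0244540; binding constraint: tail6F, next = cell4 at −2.7 %).  Constraints: cell3 0.0218870,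
cell4 0.0232910, cell5 0.0232780, tail6 0.0239482, cone 0.0206865. [cite: FitznerVanDerHofstad2016NoBLE, (3.38) p. 1071, §5.2 (5.9) p. 1091, (5.15)–(5.16) p. 1092, §5.1 p. 1093] -/
theorem srwU_zero_le_of_three_le_F_d10_n4 (x : Fin 10 → ℤ) (hx : 3 ≤ ∑ μ, |x μ|) :
    srwU 10 4 0 x ≤ ((239482 / 10000000 : ℚ) : ℝ) := by
  have hax : ∀ m : ℤ, 3 ≤ m.natAbs → srwU 10 4 0 (Pi.single (0 : Fin 10) m) ≤ ((239482 / 10000000 : ℚ) : ℝ) :=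
    axisFamily_of_cell_le_of_succ (wf_uInv 4 0) 0 (m₀ := 3) (srwU_zero_cell_d10_n4_m3 0)
      (Rat.cast_le.mpr (by norm_num)) <|
    axisFamily_of_cell_le_of_succ (wf_uInv 4 0) 0 (m₀ := 4) (srwU_zero_cell_d10_n4_m4 0)
      (Rat.cast_le.mpr (by norm_num)) <|
    axisFamily_of_cell_le_of_succ (wf_uInv 4 0) 0 (m₀ := 5) (srwU_zero_cell_d10_n4_m5 0)
      (Rat.cast_le.mpr (by norm_num)) <|
    axisFamily_of_uniform_le (F := srwU 10 4 0) 0 (M := 6)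
      (fun m hm => srwU_zero_far6F_d10_n4 0 m hm) (Rat.cast_le.mpr (by norm_num))
  have h := srwU_le_of_axisFamily_nodeBounds_three_cast (d := 10) (n := 4) (by norm_num) (by norm_num) 0 (0 : Fin 10)
    (B := bThree 4) (q := (239482 / 10000000 : ℚ)) hax (vUp_sound (n := 4) (by norm_num) (by norm_num) (l := 0) (by norm_num))
    ((wf_srwL_two_one_le (n := 4) (by norm_num) (by norm_num)).trans (Rat.cast_le.mpr (by decide +kernel)))
    ((wf_srwL_two_two_le (n := 4) (by norm_num) (by norm_num)).trans (Rat.cast_le.mpr (by decide +kernel)))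
    (fun r hr3 hr => (srwL_classVec_le_wOnes (n := 4) (by norm_num) (by norm_num) (by omega) hr).trans
      (Rat.cast_le.mpr (wf_wOnes_le_bThree 4 (by norm_num) r hr hr3)))
    (by norm_num) (by decide +kernel) x hx
  simpa only [max_self] using h

end WSixFarD10

end Literature.Probability.FitznerVanDerHofstad2017
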